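import Summits.AtomisticToContinuum.HydrodynamicLimit.Theorems.OneFlightGossipEngineAssemblyEntropyProduction
import Summits.AtomisticToContinuum.HydrodynamicLimit.Theorems.EnskogAdjointDualityDualityReductionMoments
import Summits.AtomisticToContinuum.HydrodynamicLimit.Theorems.KineticFluxLdDecay.Negative.TiltBasics
import HarnessLib

/-!
# `SwapGap` (stmt-AtomisticToContinuum-11850): statics for the pinned-entropy budget — log-densities, partition functions, moments, log-likelihood ratio

Helper file of line `Sketch` for the crux
`Summit.AtomisticToContinuum.HydrodynamicLimit.Theses.LambertianContactSwap.SwapGap`. The entropy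
currency of the line (cards `dyson-around-lambertian`: `RemainderTransfer`;
`equilibrium-superexponential-transfer`: `EquilibriumTransfer`) prices the deterministically evolved
law against the homogeneous Gibbs law `G_N` through the entropy inequality, whose constant is the
INITIAL relative entropy `H(P_N | G_N)` (pinned along the flow, `klDiv_map_flow_localGibbsLaw_const`).
This file (part 1 of 2; the budget `KL(P_N ‖ Q_N) ≤ C₀ (N+1)` itself is the sequel
`…SwapGapEntropyBudget`) collects the statics of two local Gibbs laws of `N + 1` hard spheres at
reduced diameter `σ ≤ 1/2` with continuous profiles, positive activities and temperatures:

* `log_canonicalDensity_localGibbsProfile_eq` — `log ρ(z) = −log Z + ∑ᵢ [log a(xᵢ) − (3/2) log(2πθ(xᵢ)) − |vᵢ − u(xᵢ)|²/(2θ(xᵢ))]`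
  on the hard-sphere domain;
* `exists_abs_log_posPartition_sub_le` — `|log Z_b − log Z_a| ≤ K (N+1)` (both partition functions are
  integrals of `∏ activity` over the same non-overlap set: `(inf a)^{N+1} |D_N| ≤ Z_a ≤ (sup a)^{N+1} |D_N|`);
* `exists_lintegral_sum_norm_sq_localGibbsLaw_le` — `E_{P_N} ∑ᵢ |vᵢ|² ≤ C (N+1)`;
* `llr_localGibbsLaw_ae_eq` — the log-likelihood ratio of two local Gibbs laws is `log ρ_P − log ρ_Q`
  almost surely.

Spohn 1991 Part I §2.3 (local equilibrium states have specific entropy `O(1)` relative to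
equilibrium); Yau 1991 §2; Kipnis–Landim 1999 Ch. 6 §1 (`H(μ^N | ν^N) ≤ C N`).
prover-line-stmt-AtomisticToContinuum-11850-0, cycle 1–2.
-/

noncomputable section

open MeasureTheory Filter Set Topology InformationTheory
open scoped ENNReal

namespace Summit.AtomisticToContinuum.HydrodynamicLimit.Theorems

open Literature.Analysis.FluidPDE Literature.MathematicalPhysics.KineticTheory

/-! ### Bounds on continuous profiles over the compact torus -/

/-- A continuous positive function on `𝕋³` is bounded below by a positive constant. [folklore] -/
theorem exists_pos_le_of_continuous {f : T3 → ℝ} (hf : Continuous f) (hf0 : ∀ x, 0 < f x) :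
    ∃ m : ℝ, 0 < m ∧ ∀ x, m ≤ f x := by
  obtain ⟨x₀, -, hx₀⟩ := isCompact_univ.exists_isMinOn univ_nonempty hf.continuousOn
  exact ⟨f x₀, hf0 x₀, fun x => hx₀ (mem_univ x)⟩

/-- A continuous function on `𝕋³` is bounded above. [folklore] -/
theorem exists_le_of_continuous {f : T3 → ℝ} (hf : Continuous f) : ∃ M : ℝ, ∀ x, f x ≤ M := by
  obtain ⟨M, hM⟩ := isCompact_univ.exists_bound_of_continuousOn hf.continuousOn
  exact ⟨M, fun x => (le_abs_self _).trans ((Real.norm_eq_abs _).symm.le.trans (hM x (mem_univ x)))⟩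

/-- The logarithm of a continuous positive function on `𝕋³` is bounded. [folklore] -/
theorem exists_abs_log_le_of_continuous {f : T3 → ℝ} (hf : Continuous f) (hf0 : ∀ x, 0 < f x) :
    ∃ K : ℝ, 0 ≤ K ∧ ∀ x, |Real.log (f x)| ≤ K := by
  have hc : Continuous fun x => Real.log (f x) := hf.log fun x => (hf0 x).ne'
  obtain ⟨K, hK⟩ := isCompact_univ.exists_bound_of_continuousOn hc.continuousOn
  exact ⟨max K 0, le_max_right _ _, fun x =>
    ((Real.norm_eq_abs _).symm.le.trans (hK x (mem_univ x))).trans (le_max_left _ _)⟩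

/-! ### The canonical density of a local Gibbs profile on the hard-sphere domain -/

/-- On the hard-sphere domain the canonical density of a local Gibbs profile is
`Z⁻¹ ∏ᵢ a(xᵢ) M_{1,u(xᵢ),θ(xᵢ)}(vᵢ)`. [folklore] -/
theorem canonicalDensity_localGibbsProfile_of_mem {a θ : T3 → ℝ} {u : T3 → V3} {ε : ℝ} {n : ℕ}
    {z : Config n (Fin 3) T3} (hz : z ∈ hardSphereDomain (Torus.geometry (Fin 3)) n ε) :
    canonicalDensity (Torus.geometry (Fin 3)) ε n (localGibbsProfile a u θ) z =
      (canonicalPartition (Torus.geometry (Fin 3)) ε n (localGibbsProfile a u θ))⁻¹ *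
        ∏ i, (a (z i).1 * localMaxwellian 1 (θ (z i).1) (u (z i).1) (z i).2) := by
  rw [canonicalDensity, Set.indicator_of_mem hz]
  rfl

/-- **Log of the canonical density on the hard-sphere domain**:
`log ρ(z) = −log Z + ∑ᵢ [log a(xᵢ) − (3/2) log(2πθ(xᵢ)) − |vᵢ − u(xᵢ)|²/(2θ(xᵢ))]`
(`σ ≤ 1/2`, continuous `a, θ > 0`, `u`). [folklore] -/
theorem log_canonicalDensity_localGibbsProfile_eq {a θ : T3 → ℝ} {u : T3 → V3} (ha : Continuous a)
    (hθ : Continuous θ) (hu : Continuous u) (ha0 : ∀ x, 0 < a x) (hθ0 : ∀ x, 0 < θ x) {σ : ℝ}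
    (hσ2 : σ ≤ 1 / 2) (N : ℕ) {z : Config (N + 1) (Fin 3) T3}
    (hz : z ∈ hardSphereDomain (Torus.geometry (Fin 3)) (N + 1) (hsDiameter σ N)) :
    Real.log (canonicalDensity (Torus.geometry (Fin 3)) (hsDiameter σ N) (N + 1)
        (localGibbsProfile a u θ) z) =
      -Real.log (posPartition a (hsDiameter σ N) (N + 1)) +
        ∑ i, (Real.log (a (z i).1) + (-(3 / 2) * Real.log (2 * Real.pi * θ (z i).1) -
          ‖(z i).2 - u (z i).1‖ ^ 2 / (2 * θ (z i).1))) := by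
  rw [canonicalDensity_localGibbsProfile_of_mem hz,
    canonicalPartition_eq_posPartition ha hθ hu (fun x => (ha0 x).le) hθ0,
    Real.log_mul (inv_ne_zero (posPartition_pos ha ha0 hσ2 N).ne')
      (Finset.prod_ne_zero_iff.2 fun i _ =>
        (mul_pos (ha0 _) (localMaxwellian_pos one_pos (hθ0 _) _ _)).ne'),
    Real.log_inv, Real.log_prod fun i _ =>
      (mul_pos (ha0 _) (localMaxwellian_pos one_pos (hθ0 _) _ _)).ne']
  congr 1
  refine Finset.sum_congr rfl fun i _ => ?_
  rw [Real.log_mul (ha0 _).ne' (localMaxwellian_pos one_pos (hθ0 _) _ _).ne',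
    KineticFluxLdDecayTilt.log_localMaxwellian (hθ0 _)]

/-! ### Comparison of partition functions -/

/-- Lower bound on the position weight: `(inf a)^n · 𝟙_{no overlap} ≤ posWeight a`. [folklore] -/
theorem pow_mul_indicator_le_posWeight {a : T3 → ℝ} {m : ℝ} (hm : 0 ≤ m) (hma : ∀ x, m ≤ a x)
    (ε : ℝ) {n : ℕ} (x : Fin n → T3) :
    m ^ n * (posDomain ε n).indicator (fun _ => (1 : ℝ)) x ≤ posWeight a ε n x := by
  unfold posWeight
  by_cases hx : x ∈ posDomain ε n
  · rw [Set.indicator_of_mem hx, Set.indicator_of_mem hx, mul_one]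
    calc m ^ n = ∏ _i : Fin n, m := by simp
      _ ≤ ∏ i, a (x i) := Finset.prod_le_prod (fun _ _ => hm) fun i _ => hma _
  · rw [Set.indicator_of_notMem hx, Set.indicator_of_notMem hx, mul_zero]

/-- Upper bound on the position weight through the indicator:
`posWeight a ≤ (sup a)^n · 𝟙_{no overlap}` (`0 ≤ a ≤ A`). [folklore] -/
theorem posWeight_le_pow_mul_indicator {a : T3 → ℝ} (ha0 : ∀ x, 0 ≤ a x) {A : ℝ}
    (hA : ∀ x, a x ≤ A) (ε : ℝ) {n : ℕ} (x : Fin n → T3) :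
    posWeight a ε n x ≤ A ^ n * (posDomain ε n).indicator (fun _ => (1 : ℝ)) x := by
  unfold posWeight
  by_cases hx : x ∈ posDomain ε n
  · rw [Set.indicator_of_mem hx, Set.indicator_of_mem hx, mul_one]
    calc ∏ i, a (x i) ≤ ∏ _i : Fin n, A := Finset.prod_le_prod (fun i _ => ha0 _) fun i _ => hA _
      _ = A ^ n := by simp
  · rw [Set.indicator_of_notMem hx, Set.indicator_of_notMem hx, mul_zero]

/-- The free volume `|{no overlap}|` (Lebesgue measure of the non-overlap set of `N + 1` sphere
centres at reduced diameter `σ ≤ 1/2`) is positive. [folklore] -/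
theorem volume_real_posDomain_pos {σ : ℝ} (hσ2 : σ ≤ 1 / 2) (N : ℕ) :
    0 < (volume : Measure (Fin (N + 1) → T3)).real (posDomain (hsDiameter σ N) (N + 1)) := by
  have h := posPartition_pos (a₀ := fun _ => (1 : ℝ)) continuous_const (fun _ => one_pos) hσ2 N
  rw [posPartition] at h
  have heq : (fun x => posWeight (fun _ => (1 : ℝ)) (hsDiameter σ N) (N + 1) x) =
      (posDomain (hsDiameter σ N) (N + 1)).indicator fun _ => (1 : ℝ) := by
    funext x
    unfold posWeight
    by_cases hx : x ∈ posDomain (hsDiameter σ N) (N + 1)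
    · rw [Set.indicator_of_mem hx, Set.indicator_of_mem hx]; simp
    · rw [Set.indicator_of_notMem hx, Set.indicator_of_notMem hx]
  rwa [heq, integral_indicator_const _ (measurableSet_posDomain _ _), smul_eq_mul, mul_one] at h

/-- **Two-sided comparison of configurational partition functions**: for continuous activities
`a, b > 0` on `𝕋³` there is `K ≥ 0` with `|log Z_b − log Z_a| ≤ K · (N + 1)` for every `N` at
reduced diameter `σ ≤ 1/2` (both partition functions are integrals of `∏ activity` over the SAME
non-overlap set, so `(inf a)^{N+1} |D_N| ≤ Z_a ≤ (sup a)^{N+1} |D_N|`). [folklore] -/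
theorem exists_abs_log_posPartition_sub_le {a b : T3 → ℝ} (ha : Continuous a) (hb : Continuous b)
    (ha0 : ∀ x, 0 < a x) (hb0 : ∀ x, 0 < b x) {σ : ℝ} (hσ2 : σ ≤ 1 / 2) :
    ∃ K : ℝ, 0 ≤ K ∧ ∀ N : ℕ,
      |Real.log (posPartition b (hsDiameter σ N) (N + 1)) -
          Real.log (posPartition a (hsDiameter σ N) (N + 1))| ≤ K * ((N : ℝ) + 1) := by
  obtain ⟨ma, hma0, hma⟩ := exists_pos_le_of_continuous ha ha0
  obtain ⟨mb, hmb0, hmb⟩ := exists_pos_le_of_continuous hb hb0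
  obtain ⟨Ma, hMa⟩ := exists_le_of_continuous ha
  obtain ⟨Mb, hMb⟩ := exists_le_of_continuous hb
  have hMa0 : 0 < Ma := hma0.trans_le ((hma 0).trans (hMa 0))
  have hMb0 : 0 < Mb := hmb0.trans_le ((hmb 0).trans (hMb 0))
  refine ⟨max |Real.log Mb - Real.log ma| |Real.log Ma - Real.log mb|, le_max_of_le_left (abs_nonneg _),
    fun N => ?_⟩
  set ε := hsDiameter σ N
  set V : ℝ := (volume : Measure (Fin (N + 1) → T3)).real (posDomain ε (N + 1)) with hV
  have hVpos : 0 < V := volume_real_posDomain_pos hσ2 N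
  -- `m^{N+1} V ≤ Z ≤ M^{N+1} V` for both activities
  have hind : Integrable ((posDomain ε (N + 1)).indicator fun _ => (1 : ℝ))
      (volume : Measure (Fin (N + 1) → T3)) :=
    (integrable_const _).indicator (measurableSet_posDomain _ _)
  have hintind : ∫ x, (posDomain ε (N + 1)).indicator (fun _ => (1 : ℝ)) x = V := by
    rw [integral_indicator_const _ (measurableSet_posDomain _ _), smul_eq_mul, mul_one]
  have hlow : ∀ {c : T3 → ℝ} {m : ℝ}, Continuous c → (∀ x, 0 < c x) → 0 < m → (∀ x, m ≤ c x) →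
      m ^ (N + 1) * V ≤ posPartition c ε (N + 1) := by
    intro c m hc hc0 hm hmc
    rw [posPartition, ← hintind, ← integral_const_mul]
    exact integral_mono (hind.const_mul _) (integrable_posWeight hc (fun x => (hc0 x).le) _ _)
      fun x => pow_mul_indicator_le_posWeight hm.le hmc ε x
  have hup : ∀ {c : T3 → ℝ} {M : ℝ}, Continuous c → (∀ x, 0 < c x) → (∀ x, c x ≤ M) →
      posPartition c ε (N + 1) ≤ M ^ (N + 1) * V := by
    intro c M hc hc0 hMc
    rw [posPartition, ← hintind, ← integral_const_mul]
    exact integral_mono (integrable_posWeight hc (fun x => (hc0 x).le) _ _) (hind.const_mul _)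
      fun x => posWeight_le_pow_mul_indicator (fun x => (hc0 x).le) hMc ε x
  have hZa := posPartition_pos ha ha0 hσ2 N
  have hZb := posPartition_pos hb hb0 hσ2 N
  have h1 : Real.log (posPartition b ε (N + 1)) - Real.log (posPartition a ε (N + 1)) ≤
      (Real.log Mb - Real.log ma) * ((N : ℝ) + 1) := by
    have hb' := Real.log_le_log hZb (hup hb hb0 hMb)
    have ha' := Real.log_le_log (by positivity) (hlow ha ha0 hma0 hma)
    rw [Real.log_mul (pow_pos hMb0 _).ne' hVpos.ne', Real.log_pow] at hb'
    rw [Real.log_mul (pow_pos hma0 _).ne' hVpos.ne', Real.log_pow] at ha'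
    push_cast at hb' ha' ⊢
    nlinarith
  have h2 : Real.log (posPartition a ε (N + 1)) - Real.log (posPartition b ε (N + 1)) ≤
      (Real.log Ma - Real.log mb) * ((N : ℝ) + 1) := by
    have ha' := Real.log_le_log hZa (hup ha ha0 hMa)
    have hb' := Real.log_le_log (by positivity) (hlow hb hb0 hmb0 hmb)
    rw [Real.log_mul (pow_pos hMa0 _).ne' hVpos.ne', Real.log_pow] at ha'
    rw [Real.log_mul (pow_pos hmb0 _).ne' hVpos.ne', Real.log_pow] at hb'
    push_cast at hb' ha' ⊢
    nlinarith
  have hN : (0 : ℝ) ≤ (N : ℝ) + 1 := by positivity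
  rw [abs_le]
  constructor
  · have := mul_le_mul_of_nonneg_right (le_max_right |Real.log Mb - Real.log ma|
      |Real.log Ma - Real.log mb|) hN
    have h3 := (le_abs_self (Real.log Ma - Real.log mb))
    nlinarith
  · have := mul_le_mul_of_nonneg_right (le_max_left |Real.log Mb - Real.log ma|
      |Real.log Ma - Real.log mb|) hN
    have h3 := (le_abs_self (Real.log Mb - Real.log ma))
    nlinarith


/-! ### Second velocity moments of the local Gibbs law -/

/-- **Total kinetic second moment under a local Gibbs law is `O(N)`**: there is `C ≥ 0` with
`∫⁻ ∑ᵢ |vᵢ|² dP_N ≤ C · (N + 1)` for all `N` and every flow (`σ ≤ 1/2`, continuous profiles,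
`a, θ > 0`). [folklore] -/
theorem exists_lintegral_sum_norm_sq_localGibbsLaw_le {a θ : T3 → ℝ} {u : T3 → V3}
    (ha : Continuous a) (hθ : Continuous θ) (hu : Continuous u) (ha0 : ∀ x, 0 < a x)
    (hθ0 : ∀ x, 0 < θ x) {σ : ℝ} (hσ2 : σ ≤ 1 / 2) :
    ∃ C : ℝ, 0 ≤ C ∧ ∀ (N : ℕ)
      (Φ : HardSphereFlow (Torus.geometry (Fin 3)) (hsDiameter σ N) (N + 1)),
      ∫⁻ z, ENNReal.ofReal (∑ i, ‖(z i).2‖ ^ 2) ∂localGibbsLaw σ a u θ N Φ ≤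
        ENNReal.ofReal (C * ((N : ℝ) + 1)) := by
  obtain ⟨C, hC0, hC⟩ := lintegral_avg_norm_pow_localGibbsMeasure_le ha hθ hu
    (fun x => (ha0 x).le) hθ0 σ (n := 2) two_ne_zero
  refine ⟨C, hC0, fun N Φ => ?_⟩
  have hP := isProbabilityMeasure_localGibbsMeasure ha hθ hu ha0 hθ0 hσ2 N
  have h := hC N hP
  rw [localGibbsLaw_eq]
  have hNpos : (0 : ℝ) < ((N + 1 : ℕ) : ℝ) := by positivity
  have hmeas : Measurable fun z : Config (N + 1) (Fin 3) T3 =>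
      ENNReal.ofReal (((N + 1 : ℕ) : ℝ)⁻¹ * ∑ i, ‖(z i).2‖ ^ 2) := by
    refine (measurable_const.mul (Finset.measurable_sum _ fun i _ => ?_)).ennreal_ofReal
    exact ((measurable_pi_apply i).snd.norm).pow_const 2
  have hpt : ∀ z : Config (N + 1) (Fin 3) T3, ENNReal.ofReal (∑ i, ‖(z i).2‖ ^ 2) =
      ENNReal.ofReal ((N + 1 : ℕ) : ℝ) *
        ENNReal.ofReal (((N + 1 : ℕ) : ℝ)⁻¹ * ∑ i, ‖(z i).2‖ ^ 2) := by
    intro z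
    rw [← ENNReal.ofReal_mul hNpos.le, ← mul_assoc, mul_inv_cancel₀ hNpos.ne', one_mul]
  simp_rw [hpt]
  rw [lintegral_const_mul _ hmeas]
  calc ENNReal.ofReal ((N + 1 : ℕ) : ℝ) *
        ∫⁻ z, ENNReal.ofReal (((N + 1 : ℕ) : ℝ)⁻¹ * ∑ i, ‖(z i).2‖ ^ 2)
          ∂localGibbsMeasure σ a u θ N
      ≤ ENNReal.ofReal ((N + 1 : ℕ) : ℝ) * ENNReal.ofReal C := by gcongr
    _ = ENNReal.ofReal (C * ((N : ℝ) + 1)) := by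
        rw [← ENNReal.ofReal_mul hNpos.le, mul_comm]
        push_cast
        ring_nf

/-! ### The log-likelihood ratio of two local Gibbs laws -/

/-- The local Gibbs law is the Liouville measure with density the canonical density (unfolding).
[folklore] -/
theorem localGibbsLaw_eq_withDensity_liouville (σ : ℝ) (a θ : T3 → ℝ) (u : T3 → V3) (N : ℕ)
    (Φ : HardSphereFlow (Torus.geometry (Fin 3)) (hsDiameter σ N) (N + 1)) :
    localGibbsLaw σ a u θ N Φ =
      (liouville (Torus.geometry (Fin 3)) (N + 1) (hsDiameter σ N)).withDensity fun z =>
        ENNReal.ofReal (canonicalDensity (Torus.geometry (Fin 3)) (hsDiameter σ N) (N + 1)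
          (localGibbsProfile a u θ) z) := rfl

/-- **The log-likelihood ratio of two local Gibbs laws** (same `σ ≤ 1/2`, continuous profiles,
positive activities and temperatures) is, almost surely under the first law, the difference of the
logarithms of the two canonical densities. [folklore] -/
theorem llr_localGibbsLaw_ae_eq {a θ b ϑ : T3 → ℝ} {u w : T3 → V3} (ha : Continuous a)
    (hθ : Continuous θ) (hu : Continuous u) (ha0 : ∀ x, 0 < a x) (hθ0 : ∀ x, 0 < θ x)
    (hb : Continuous b) (hϑ : Continuous ϑ) (hw : Continuous w) (hb0 : ∀ x, 0 < b x)
    (hϑ0 : ∀ x, 0 < ϑ x) {σ : ℝ} (hσ2 : σ ≤ 1 / 2) (N : ℕ)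
    (Φ : HardSphereFlow (Torus.geometry (Fin 3)) (hsDiameter σ N) (N + 1)) :
    llr (localGibbsLaw σ a u θ N Φ) (localGibbsLaw σ b w ϑ N Φ) =ᵐ[localGibbsLaw σ a u θ N Φ]
      fun z => Real.log (canonicalDensity (Torus.geometry (Fin 3)) (hsDiameter σ N) (N + 1)
          (localGibbsProfile a u θ) z) -
        Real.log (canonicalDensity (Torus.geometry (Fin 3)) (hsDiameter σ N) (N + 1)
          (localGibbsProfile b w ϑ) z) := by
  haveI hXE : SigmaFinite (volume : Measure (T3 × V3)) := inferInstance
  haveI hC : SigmaFinite (volume : Measure (Config (N + 1) (Fin 3) T3)) := inferInstance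
  haveI hL : SigmaFinite (liouville (Torus.geometry (Fin 3)) (N + 1) (hsDiameter σ N)) := by
    rw [liouville_eq]; infer_instance
  have hfm := (measurable_canonicalDensity (hsDiameter σ N) (N + 1)
    (measurable_localGibbsProfile ha hθ hu)).ennreal_ofReal
  have hgm := (measurable_canonicalDensity (hsDiameter σ N) (N + 1)
    (measurable_localGibbsProfile hb hϑ hw)).ennreal_ofReal
  have h := llr_withDensity_ae_eq (liouville (Torus.geometry (Fin 3)) (N + 1) (hsDiameter σ N))
    hfm hgm (Eventually.of_forall fun _ => ENNReal.ofReal_ne_top)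
    (ae_canonicalDensity_localGibbsProfile_ne_zero hb hϑ hw hb0 hϑ0 hσ2 N)
    (Eventually.of_forall fun _ => ENNReal.ofReal_ne_top)
  rw [localGibbsLaw_eq_withDensity_liouville, localGibbsLaw_eq_withDensity_liouville]
  filter_upwards [h] with z hz
  rw [hz, ENNReal.toReal_ofReal (canonicalDensity_localGibbsProfile_nonneg (fun x => (ha0 x).le)
      (fun x => (hθ0 x).le) _ _ z),
    ENNReal.toReal_ofReal (canonicalDensity_localGibbsProfile_nonneg (fun x => (hb0 x).le)
      (fun x => (hϑ0 x).le) _ _ z)]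

end Summit.AtomisticToContinuum.HydrodynamicLimit.Theorems
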